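import Summits.BirchSwinnertonDyer.BirchSwinnertonDyer.Theorems.SchneiderFreeAdditiveX3PoitouTatePresentationReadout
import Summits.BirchSwinnertonDyer.BirchSwinnertonDyer.Theorems.CumulativeHeegnerLeopoldtRedSplitControlAtThreeShaDualPerfectOfReadout
import Summits.BirchSwinnertonDyer.BirchSwinnertonDyer.Theorems.CumulativeHeegnerLeopoldtRedSplitControlAtThreeShaDualAnnihilatorCanonical
import Summits.BirchSwinnertonDyer.BirchSwinnertonDyer.Theorems.KolyvaginRoadThreePTDevissageCofinite
import Literature.AnabelianGeometry.AbsoluteAnabelian.LocalResidueMapQmodZ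
import HarnessLib

/-!
# Poitou–Tate, degree two: the PERFECT PAIRING `Ш²(K, M) × Ш¹(K, M^D) → ℤ/n` (the conclusion of
# `poitouTate_sha_tateDual` at one module) from the presentation road of cell `bsd-schneider` PLUS a
# degree-`2` OBSTRUCTION MAP `Ψ : Hom_{C_Γ}(N₁, C̄) → Ш²(K, M)` — the "Ш²-readout road"

Cell `bsd-wall`, seat `bsd-line-chl-p2` g6 (width prover on crux K4 `RedSplitControlAtThree`,
stmt-BirchSwinnertonDyer-24200; stub `stub_poitouTateShaTateDual` = the named fact `poitouTate_sha_tateDual K`, item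
20462).  Gen 5 reduced the named fact at a TOTALLY COMPLEX `K` to a READOUT
`e : Ш²(K, M) → Hom(H¹(K, M^D), ℤ/n)` that is additive, injective and surjective modulo sums of local Tate pairings
(`PoitouTateShaAnnihilator.sha_tateDual_of_readout`).  This file CONSTRUCTS that readout from named, lemma-shaped inputs
in the currency of the presentation road (`SchneiderFreeAdditiveX3.PoitouTateReduction.middleExact_allPlaces_of_readout_inv`,
door-c6 g16/g17), so that the degree-`≤ 1` inputs are EXACTLY those the road to `hE` (Milne I 4.10 (b)) discharges, and the
new, degree-`2` input is isolated as ONE additive map with five properties.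

THE ARGUMENT (Milne, *ADT* I, proof of Thm. 4.10 (a), p. 58: `Ш²(K, M) ≅ Coker(Ext¹(M^D, J̄) → Ext¹(M^D, C̄)) ≅
Coker(γ¹) ≅ Ш¹(K, M^D)^*`, run at the level of HOMOMORPHISMS out of the relation module `N₁` of a presentation).  Fix a
number field `K`, `n ≥ 1`, a finite discrete `n`-torsion `Γ_K`-module `ρ` on `M`, a short exact
`S : 0 → N₁ → N₂ → N → 0` in door-c4's `C_Γ = DiscreteRepCat ℤ Γ_K` (intended: the free presentation of the module whose
Tate dual is `ρ`), door-c5's `T : 0 → F̄ˣ → J̄ → C̄ → 0` (`ideleClassLimitShortComplex K`) and an invariant map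
`inv : Ext²_{C_Γ}(ℤ, C̄) → ℚ/ℤ`.  INPUTS:
* (α) Tate: `α¹(Γ_K, N) : Ext¹(N, C̄) → Hom(Ext¹(ℤ, N), ℚ/ℤ)` is BIJECTIVE (door-c4 `DiscreteRep.tateDuality_finite`);
* (∂) `Ext¹_{C_Γ}(N₂, C̄) = 0`, so that `∂ : Hom(N₁, C̄) → Ext¹(N, C̄)` is onto (`ExtPresentation.boundary_surjective`;
  for the free presentation this is `H¹(U, C̄) = 0` at the layers, `IdeleClassGroup.isZero_H1_res_galoisRep`);
* (R3) a READOUT `R_v : Hom(N₁, J̄) → H¹(K_v, M)` onto the admissible families of local classes (verbatim the hypothesis of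
  the degree-`1` road);
* (nat, R4) an additive bijection `nat : H¹(K, M^D) ≅ Ext¹_{C_Γ}(ℤ, N)` under which, for every `f : N₁ → J̄`, the
  functional `y ↦ inv(nat y ∘ ∂(f ≫ g))` IS the sum of the local Tate pairings `∑_v inv_v(R_v f ∪ loc_v y)` (read in `ℚ/ℤ`
  through `ℤ/n ↪ ℚ/ℤ`) on the classes `y` unramified off a large finite set — the EQUALITY form of the road's (R4);
* (Ψ) THE DEGREE-2 INPUT: an additive `Ψ : Hom_{C_Γ}(N₁, C̄) → H²(K, M)` with (a) `Ψ(f ≫ g) = 0` for `f : N₁ → J̄`,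
  (b) `Ψ(ι ≫ q) = 0` for `q : N₂ → C̄`, (c) `Ψ h = 0 ⟹ h = f ≫ g` for some `f`, (d) `Ψ h ∈ Ш²(K, M)`, (e) `Ш²(K, M) ⊆ Im Ψ`
  (intended: `Ψ = H²(e⁻¹) ∘ δ₁^{dual} ∘ δ₀^{T}`, the connecting map `Hom_Γ(N₁, C̄) → H¹(K, Hom(N₁, K̄ˣ))` of `Hom(N₁, T)`
  followed by the degree-`1 → 2` connecting map of the dual sequence `0 → Hom(N, K̄ˣ) → Hom(N₂, K̄ˣ) → Hom(N₁, K̄ˣ) → 0`;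
  (a)–(c) = exactness + `H¹(K, Hom(N₂, K̄ˣ)) = 0` (`HomPermutation.galoisCohomology_hom_units_eq_zero`), (d) = the local
  version through the idèle projections, (e) = Brauer–Hasse–Noether for the layer field + Shapiro in degree `2`).
THEN the readout `e(c) := (ℤ/n ↪ ℚ/ℤ)⁻¹ ∘ (y ↦ inv(nat y ∘ ∂ h_c))` for any `h_c` with `Ψ h_c = c` has the three properties
of `sha_tateDual_of_readout`: ADDITIVE modulo local sums (by (c) and (R4)); INJECTIVE modulo local sums (a local sum is the
functional of `∂(f ≫ g)` by (R3)+(R4), so `α¹(∂(h_c − f ≫ g)) = 0`, so `h_c − f ≫ g = ι ≫ q` by (α)+exactness at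
`Hom(N₁, C̄)`, so `c = Ψ h_c = 0` by (a)(b)); SURJECTIVE modulo local sums (every character of `H¹(K, M^D)` is `α¹(∂ h)` by
(α)+(∂), and `Ψ h ∈ Ш²` by (d)).  With `K` totally complex and the canonical invariant maps (`canonical_isPerfect`, Milne I
2.6 at all levels, and `SelmerComplement` = the output of `hE(n)`), gen 5's theorem gives the perfect pairing.

* `exists_zmodToQmodZ_eq_of_nsmul_eq_zero`, `exists_addMonoidHom_zmodToQmodZ_eq` — `(1/n)ℤ/ℤ = Im(ℤ/n ↪ ℚ/ℤ)`: an
  `ℚ/ℤ`-valued additive map on an `n`-torsion group factors through `ℤ/n`;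
* **`shaTwo_tateDual_of_presentation_readout`** — the statement above (module level, `S` abstract).  The sequel
  `…ShaTwoReadoutRoadPresentation` runs it on door-c4's canonical presentation with `hα` and (∂) discharged.

HONEST FRAMING: THEOREMS ONLY; a reduction — (R3), (R4) (cell `bsd-schneider`, in progress) and the five properties of `Ψ`
(new) are genuine displayed hypotheses on existing objects; closes no item; no case of Poitou–Tate or BSD is proved here.

References: [MilneADT2006] I Thm. 4.10 (a) and its proof (p. 58), Lemma 4.13, Thm. 1.8; [Harari2020] Thm. 17.13 (b),
§16.3; [Weibel1994] §2.7.
-/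

noncomputable section

open Function NumberField IsDedekindDomain CategoryTheory CategoryTheory.Abelian
open scoped NumberField

set_option linter.dupNamespace false
set_option autoImplicit false

namespace Summit.BirchSwinnertonDyer.BirchSwinnertonDyer.Theorems.PoitouTateShaTwoReadout

open Field
open Literature.NumberTheory.GaloisRepresentations Literature.NumberTheory.GaloisCohomology
open Literature.NumberTheory.GaloisRepresentations.DiscreteGaloisModule (TateDual tateDual localTatePairingZMod
  unramifiedSubgroup sha shaTwo)
open Literature.Algebra.Homology Literature.Algebra.Homology.DiscreteRep Literature.Algebra.Homology.ExtPresentation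
open Literature.NumberTheory.GaloisRepresentations.IdeleClassBar (classBarD)
open Literature.AnabelianGeometry.AbsoluteAnabelian.Prop121vii (zmodToQmodZ zmodToQmodZ_injective)
open Summit.BirchSwinnertonDyer.BirchSwinnertonDyer.Theorems.PoitouTateShaAnnihilator (sha_tateDual_of_readout)
open Summit.BirchSwinnertonDyer.BirchSwinnertonDyer.Theorems.SchneiderFreeAdditiveX3.PoitouTateReduction
  (unramifiedOrthogonal_of_isPerfect_allLevels)
open Summit.BirchSwinnertonDyer.BirchSwinnertonDyer.Theorems.KolyvaginRoadThreePT
  (exists_finset_localization_mem_unramifiedSubgroup)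

/-! ## §1 `ℚ/ℤ`-valued additive maps on `n`-torsion groups factor through `ℤ/n ↪ ℚ/ℤ` -/

section ZMod

variable {n : ℕ} [NeZero n]

/-- **`(ℚ/ℤ)[n] = (1/n)ℤ/ℤ`**: an `n`-torsion element of `ℚ/ℤ` is `k/n` for some `k ∈ ℤ/n`. [folklore] -/
theorem exists_zmodToQmodZ_eq_of_nsmul_eq_zero (q : AddCircle (1 : ℚ)) (hq : n • q = 0) :
    ∃ z : ZMod n, zmodToQmodZ n z = q := by
  obtain ⟨r, rfl⟩ := QuotientAddGroup.mk_surjective q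
  change n • ((r : ℚ) : AddCircle (1 : ℚ)) = 0 at hq
  rw [← AddCircle.coe_nsmul, AddCircle.coe_eq_zero_iff] at hq
  obtain ⟨m, hm⟩ := hq
  rw [zsmul_eq_mul, mul_one, nsmul_eq_mul] at hm
  have hn : (n : ℚ) ≠ 0 := Nat.cast_ne_zero.2 (NeZero.ne n)
  refine ⟨(m : ZMod n), ?_⟩
  rw [zmodToQmodZ, ZMod.lift_coe]
  change ((((m : ℚ)) / n : ℚ) : AddCircle (1 : ℚ)) = ((r : ℚ) : AddCircle (1 : ℚ))
  rw [hm, mul_div_cancel_left₀ r hn]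

/-- **An additive map `E : A → ℚ/ℤ` on an `n`-torsion group `A` factors through `ℤ/n ↪ ℚ/ℤ`**: there is an additive
`φ : A → ℤ/n` with `E a = φ(a)/n`. [folklore] -/
theorem exists_addMonoidHom_zmodToQmodZ_eq {A : Type*} [AddCommGroup A] (hA : ∀ a : A, n • a = 0)
    (E : A →+ AddCircle (1 : ℚ)) : ∃ φ : A →+ ZMod n, ∀ a : A, zmodToQmodZ n (φ a) = E a := by
  have h : ∀ a : A, ∃ z : ZMod n, zmodToQmodZ n z = E a := fun a =>
    exists_zmodToQmodZ_eq_of_nsmul_eq_zero (E a) (by rw [← map_nsmul, hA, map_zero])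
  choose φ hφ using h
  refine ⟨{ toFun := φ, map_zero' := ?_, map_add' := ?_ }, fun a => hφ a⟩
  · apply zmodToQmodZ_injective n
    rw [hφ, map_zero, map_zero]
  · intro a b
    apply zmodToQmodZ_injective n
    rw [hφ, map_add, map_add, hφ, hφ]

end ZMod

/-! ## §2 The `Ш²`-readout road -/

section Road

variable {K : Type} [Field K] [NumberField K]

/-- **Milne I Thm. 4.10 (a) at one module from the presentation road plus a degree-`2` obstruction map.**  `K` totally
complex, `n ≥ 1`, `ρ` a finite discrete `n`-torsion `Γ_K`-module unramified off the finite `S₀ ⊇ {v ∣ ∞} ∪ {v ∣ n}`,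
`Ш¹(K, M^D)` finite; the canonical local invariant maps satisfy `SelmerComplement` (= the output of `hE(n)`,
`selmerComplement_canonical_of_middleExact_allLevels`).  Given the degree-`≤ 1` package of the presentation road — an
invariant map `inv` of `C̄`, a short exact `S : 0 → N₁ → N₂ → N → 0` in `C_Γ` with `α¹(Γ_K, N)` BIJECTIVE and
`Ext¹(N₂, C̄) = 0`, a readout `R_v : Hom(N₁, J̄) → H¹(K_v, M)` with the surjectivity (R3), and an additive bijection
`nat : H¹(K, M^D) ≅ Ext¹(ℤ, N)` with the pairing identity (R4) `(1/n)·∑_{v ∈ T'} inv_v(R_v f ∪ loc_v y) = inv(nat y ∘ ∂(f ≫ g))`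
— and the degree-`2` package — an additive `Ψ : Hom(N₁, C̄) → H²(K, M)` with `Ψ(f ≫ g) = 0`, `Ψ(ι ≫ q) = 0`,
`Ψ h = 0 ⟹ h = f ≫ g`, `Ψ h ∈ Ш²(K, M)`, `Ш²(K, M) ⊆ Im Ψ` — the group `Ш²(K, M)` is finite and there is a bi-additive
`b : Ш²(K, M) × Ш¹(K, M^D) → ℤ/n` both of whose adjoints are bijective (verbatim the conclusion of
`poitouTate_sha_tateDual K` at `(n, M, ρ)`).  See the module docstring for the argument and the intended discharges.
[cite: MilneADT2006, Ch. I, Thm. 4.10 (a) (proof, p. 58), Lemma 4.13, Thm. 1.8][cite: Harari2020, Thm. 17.13 (b), §16.3] -/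
theorem shaTwo_tateDual_of_presentation_readout [IsTotallyComplex K] {n : ℕ} [NeZero n]
    (hcomp : (LocalInvariants.canonical K n).SelmerComplement)
    {M : Type} [AddCommGroup M] [TopologicalSpace M] [DiscreteTopology M] [Finite M]
    (ρ : DiscreteGaloisModule K M) (hM : ∀ m : M, n • m = 0)
    (S₀ : Finset (Place K)) (hinf : ∀ w : InfinitePlace K, (Sum.inl w : Place K) ∈ S₀)
    (hS₀ : ∀ v : HeightOneSpectrum (𝓞 K), (Sum.inr v : Place K) ∉ S₀ →
      ((n : ℕ) : 𝓞 K) ∉ v.asIdeal ∧ GaloisRep.IsUnramifiedAt v ρ)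
    [Finite (sha (ρ.tateDual n))]
    (inv : Abelian.Ext (triv (Γ := absoluteGaloisGroup K) ℤ) (classBarD K) 2 →+ AddCircle (1 : ℚ))
    {S : ShortComplex (DiscreteRepCat ℤ (absoluteGaloisGroup K))} (hS : S.ShortExact)
    (hα : Function.Bijective
      (ExtDuality.adjointMap (P := triv (Γ := absoluteGaloisGroup K) ℤ) inv S.X₃ (rfl : 1 + 1 = 2)))
    (hPC : ∀ x : Abelian.Ext S.X₂ (classBarD K) 1, x = 0)
    (R : ∀ v : Place K, (S.X₁ ⟶ (ideleClassLimitShortComplex K).X₂) →+ galoisCohomology (ρ.toLocal v) 1)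
    (hR3 : ∀ T : Finset (Place K), (∀ w : InfinitePlace K, (Sum.inl w : Place K) ∈ T) →
      (∀ v : HeightOneSpectrum (𝓞 K), (Sum.inr v : Place K) ∉ T →
        ((n : ℕ) : 𝓞 K) ∉ v.asIdeal ∧ GaloisRep.IsUnramifiedAt v ρ) →
      ∀ t : Π v : Place K, galoisCohomology (ρ.toLocal v) 1,
        (∀ v : HeightOneSpectrum (𝓞 K), (Sum.inr v : Place K) ∉ T →
          t (Sum.inr v) ∈ unramifiedSubgroup (GaloisRep.toLocal v ρ) 1) →
        ∃ f : S.X₁ ⟶ (ideleClassLimitShortComplex K).X₂, ∀ v : Place K, R v f = t v)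
    (nat : galoisCohomology (ρ.tateDual n) 1 →+ Abelian.Ext (triv (Γ := absoluteGaloisGroup K) ℤ) S.X₃ 1)
    (hnat : Function.Bijective nat)
    (hR4 : ∀ f : S.X₁ ⟶ (ideleClassLimitShortComplex K).X₂, ∃ Tf : Finset (Place K),
      ∀ (y : galoisCohomology (ρ.tateDual n) 1) (T' : Finset (Place K)), Tf ⊆ T' →
        (∀ v : HeightOneSpectrum (𝓞 K), (Sum.inr v : Place K) ∉ T' →
          galoisCohomology.localization (ρ.tateDual n) (Sum.inr v) 1 y ∈
            unramifiedSubgroup (GaloisRep.toLocal v (ρ.tateDual n)) 1) →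
        zmodToQmodZ n (∑ v ∈ T', localTatePairingZMod ρ n v (LocalInvariants.canonical K n v) (R v f)
          (galoisCohomology.localization (ρ.tateDual n) v 1 y)) =
        inv ((nat y).comp (boundary hS (classBarD K) (f ≫ (ideleClassLimitShortComplex K).g))
          (rfl : 1 + 1 = 2)))
    (Ψ : (S.X₁ ⟶ classBarD K) →+ galoisCohomology ρ 2)
    (hΨg : ∀ f : S.X₁ ⟶ (ideleClassLimitShortComplex K).X₂, Ψ (f ≫ (ideleClassLimitShortComplex K).g) = 0)
    (hΨf : ∀ q : S.X₂ ⟶ classBarD K, Ψ (S.f ≫ q) = 0)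
    (hΨker : ∀ h : S.X₁ ⟶ classBarD K, Ψ h = 0 →
      ∃ f : S.X₁ ⟶ (ideleClassLimitShortComplex K).X₂, h = f ≫ (ideleClassLimitShortComplex K).g)
    (hΨsha : ∀ h : S.X₁ ⟶ classBarD K, Ψ h ∈ shaTwo ρ)
    (hΨsurj : ∀ c ∈ shaTwo ρ, ∃ h : S.X₁ ⟶ classBarD K, Ψ h = c) :
    Finite (shaTwo ρ) ∧ ∃ b : shaTwo ρ →+ sha (ρ.tateDual n) →+ ZMod n,
      Function.Bijective b ∧ Function.Bijective b.flip := by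
  classical
  -- `H¹(K, M^D)` is `n`-torsion
  have hN1 : ∀ y : galoisCohomology (ρ.tateDual n) 1, n • y = 0 := fun y =>
    galoisCohomology.nsmul_eq_zero_of_forall _ (fun f => DiscreteGaloisModule.TateDual.nsmul_eq_zero f) y
  -- the bridge as an additive equivalence
  let natE : galoisCohomology (ρ.tateDual n) 1 ≃+
      Abelian.Ext (triv (Γ := absoluteGaloisGroup K) ℤ) S.X₃ 1 := AddEquiv.ofBijective nat hnat
  have hnatE : ∀ y, natE y = nat y := fun _ => rfl
  -- the `ℚ/ℤ`-valued functional `y ↦ inv (nat y ∘ ∂ h)` of a homomorphism `h : N₁ → C̄`, additive in `h`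
  let EH : (S.X₁ ⟶ classBarD K) →+ (galoisCohomology (ρ.tateDual n) 1 →+ AddCircle (1 : ℚ)) :=
    AddMonoidHom.mk' (fun h =>
      (ExtDuality.adjointMap (P := triv (Γ := absoluteGaloisGroup K) ℤ) inv S.X₃ (rfl : 1 + 1 = 2)
        (boundary hS (classBarD K) h)).comp nat)
      (fun h h' => by rw [map_add, map_add, AddMonoidHom.add_comp])
  have hEH : ∀ (h : S.X₁ ⟶ classBarD K) (y : galoisCohomology (ρ.tateDual n) 1),
      EH h y = inv ((nat y).comp (boundary hS (classBarD K) h) (rfl : 1 + 1 = 2)) := fun _ _ => rfl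
  -- its `ℤ/n`-valued lift
  have hfac : ∀ h : S.X₁ ⟶ classBarD K, ∃ φ : galoisCohomology (ρ.tateDual n) 1 →+ ZMod n,
      ∀ y, zmodToQmodZ n (φ y) = EH h y := fun h => exists_addMonoidHom_zmodToQmodZ_eq hN1 (EH h)
  choose eh heh using hfac
  have heh_sub : ∀ (h h' : S.X₁ ⟶ classBarD K) (y : galoisCohomology (ρ.tateDual n) 1),
      eh (h - h') y = eh h y - eh h' y := fun h h' y => by
    apply zmodToQmodZ_injective n
    rw [map_sub, heh, heh, heh, map_sub, AddMonoidHom.sub_apply]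
  -- lifts of the `Ш²`-classes along `Ψ`
  choose lift hlift using hΨsurj
  -- THE READOUT
  let e : shaTwo ρ → (galoisCohomology (ρ.tateDual n) 1 →+ ZMod n) := fun c => eh (lift c.1 c.2)
  have he : ∀ c : shaTwo ρ, e c = eh (lift c.1 c.2) := fun _ => rfl
  -- the functional of `f ≫ g` is a local sum: (R4), read in `ℤ/n`
  have hloc : ∀ f : S.X₁ ⟶ (ideleClassLimitShortComplex K).X₂, ∃ Tf : Finset (Place K),
      ∀ (y : galoisCohomology (ρ.tateDual n) 1) (T' : Finset (Place K)), Tf ⊆ T' →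
        (∀ v : HeightOneSpectrum (𝓞 K), (Sum.inr v : Place K) ∉ T' →
          galoisCohomology.localization (ρ.tateDual n) (Sum.inr v) 1 y ∈
            unramifiedSubgroup (GaloisRep.toLocal v (ρ.tateDual n)) 1) →
        eh (f ≫ (ideleClassLimitShortComplex K).g) y =
          ∑ v ∈ T', localTatePairingZMod ρ n v (LocalInvariants.canonical K n v) (R v f)
            (galoisCohomology.localization (ρ.tateDual n) v 1 y) := by
    intro f
    obtain ⟨Tf, hTf⟩ := hR4 f
    refine ⟨Tf, fun y T' hT' hy => ?_⟩
    apply zmodToQmodZ_injective n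
    rw [heh, hEH, hTf y T' hT' hy]
  -- every class is unramified off a finite set of places
  have hur_y : ∀ (y : galoisCohomology (ρ.tateDual n) 1) (T₀ : Finset (Place K)), ∃ T' : Finset (Place K),
      T₀ ⊆ T' ∧ ∀ v : HeightOneSpectrum (𝓞 K), (Sum.inr v : Place K) ∉ T' →
        galoisCohomology.localization (ρ.tateDual n) (Sum.inr v) 1 y ∈
          unramifiedSubgroup (GaloisRep.toLocal v (ρ.tateDual n)) 1 := by
    intro y T₀
    obtain ⟨Ty, hTy⟩ := exists_finset_localization_mem_unramifiedSubgroup (ρ.tateDual n) y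
    refine ⟨T₀ ∪ Ty.image Sum.inr, Finset.subset_union_left, fun v hv => hTy v fun hvT => hv ?_⟩
    exact Finset.mem_union_right _ (Finset.mem_image_of_mem _ hvT)
  -- two homomorphisms with the same functional differ by `ι ≫ q`, so have the same `Ψ`
  have hΨ_eq_of_EH : ∀ h h' : S.X₁ ⟶ classBarD K, EH h = EH h' → Ψ h = Ψ h' := by
    intro h h' hhh
    have h1 : ExtDuality.adjointMap (P := triv (Γ := absoluteGaloisGroup K) ℤ) inv S.X₃ (rfl : 1 + 1 = 2)
        (boundary hS (classBarD K) h) =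
        ExtDuality.adjointMap (P := triv (Γ := absoluteGaloisGroup K) ℤ) inv S.X₃ (rfl : 1 + 1 = 2)
        (boundary hS (classBarD K) h') :=
      (AddMonoidHom.cancel_right hnat.2).1 hhh
    have h2 : boundary hS (classBarD K) h = boundary hS (classBarD K) h' := hα.1 h1
    obtain ⟨q, hq⟩ := (boundary_eq_boundary_iff hS h h').1 h2
    rw [hq, map_add, hΨf, add_zero]
  -- (add): `e` is additive modulo local sums
  have hadd : ∀ c c' : shaTwo ρ, ∃ (S₁ : Finset (Place K)) (t : Π v : Place K, galoisCohomology (ρ.toLocal v) 1),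
      ∀ (y : galoisCohomology (ρ.tateDual n) 1) (S' : Finset (Place K)), S₁ ⊆ S' →
        (∀ v : HeightOneSpectrum (𝓞 K), (Sum.inr v : Place K) ∉ S' →
          galoisCohomology.localization (ρ.tateDual n) (Sum.inr v) 1 y ∈
            unramifiedSubgroup (GaloisRep.toLocal v (ρ.tateDual n)) 1) →
        (e (c + c') - e c - e c') y = ∑ v ∈ S', localTatePairingZMod ρ n v (LocalInvariants.canonical K n v) (t v)
          (galoisCohomology.localization (ρ.tateDual n) v 1 y) := by
    intro c c'
    set d : S.X₁ ⟶ classBarD K := lift (c + c').1 (c + c').2 - lift c.1 c.2 - lift c'.1 c'.2 with hd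
    have hΨd : Ψ d = 0 := by
      rw [hd, map_sub, map_sub, hlift, hlift, hlift, AddSubgroup.coe_add, add_sub_cancel_left, sub_self]
    obtain ⟨f, hf⟩ := hΨker d hΨd
    obtain ⟨Tf, hTf⟩ := hloc f
    refine ⟨Tf, fun v => R v f, fun y S' hS' hy => ?_⟩
    rw [AddMonoidHom.sub_apply, AddMonoidHom.sub_apply, he, he, he, ← heh_sub, ← heh_sub, ← hd, hf]
    exact hTf y S' hS' hy
  -- (inj): a class whose readout is a local sum vanishes
  have hinj : ∀ c : shaTwo ρ, (∃ (S₁ : Finset (Place K)) (t : Π v : Place K, galoisCohomology (ρ.toLocal v) 1),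
      S₀ ⊆ S₁ ∧ (∀ w : InfinitePlace K, t (Sum.inl w) = 0) ∧
      (∀ v : HeightOneSpectrum (𝓞 K), (Sum.inr v : Place K) ∉ S₁ →
        t (Sum.inr v) ∈ unramifiedSubgroup (GaloisRep.toLocal v ρ) 1) ∧
      ∀ (y : galoisCohomology (ρ.tateDual n) 1) (S' : Finset (Place K)), S₁ ⊆ S' →
        (∀ v : HeightOneSpectrum (𝓞 K), (Sum.inr v : Place K) ∉ S' →
          galoisCohomology.localization (ρ.tateDual n) (Sum.inr v) 1 y ∈
            unramifiedSubgroup (GaloisRep.toLocal v (ρ.tateDual n)) 1) →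
        e c y = ∑ v ∈ S', localTatePairingZMod ρ n v (LocalInvariants.canonical K n v) (t v)
          (galoisCohomology.localization (ρ.tateDual n) v 1 y)) → c = 0 := by
    rintro c ⟨S₁, t, hS₀S₁, -, htur, hct⟩
    -- `t` is the readout of one `f : N₁ → J̄` (R3)
    obtain ⟨f, hf⟩ := hR3 S₁ (fun w => hS₀S₁ (hinf w)) (fun v hv => hS₀ v fun hv' => hv (hS₀S₁ hv')) t htur
    obtain ⟨Tf, hTf⟩ := hloc f
    -- the functionals of `h_c` and of `f ≫ g` agree
    have hfun : EH (lift c.1 c.2) = EH (f ≫ (ideleClassLimitShortComplex K).g) := by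
      ext y
      obtain ⟨S', hS', hy⟩ := hur_y y (S₁ ∪ Tf)
      have h1 : e c y = ∑ v ∈ S', localTatePairingZMod ρ n v (LocalInvariants.canonical K n v) (t v)
          (galoisCohomology.localization (ρ.tateDual n) v 1 y) :=
        hct y S' (Finset.union_subset_left hS') hy
      have h2 := hTf y S' (Finset.union_subset_right hS') hy
      rw [← heh, ← heh, ← he, h1, h2]
      exact congrArg _ (Finset.sum_congr rfl fun v _ => by rw [hf v])
    have hΨ := hΨ_eq_of_EH _ _ hfun
    rw [hlift, hΨg] at hΨ
    exact Subtype.ext hΨ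
  -- (surj): every character of `H¹(K, M^D)` is a readout plus a local sum
  have hsurj : ∀ φ : galoisCohomology (ρ.tateDual n) 1 →+ ZMod n, ∃ (c : shaTwo ρ) (S₁ : Finset (Place K))
      (t : Π v : Place K, galoisCohomology (ρ.toLocal v) 1),
      ∀ (y : galoisCohomology (ρ.tateDual n) 1) (S' : Finset (Place K)), S₁ ⊆ S' →
        (∀ v : HeightOneSpectrum (𝓞 K), (Sum.inr v : Place K) ∉ S' →
          galoisCohomology.localization (ρ.tateDual n) (Sum.inr v) 1 y ∈
            unramifiedSubgroup (GaloisRep.toLocal v (ρ.tateDual n)) 1) →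
        (φ - e c) y = ∑ v ∈ S', localTatePairingZMod ρ n v (LocalInvariants.canonical K n v) (t v)
          (galoisCohomology.localization (ρ.tateDual n) v 1 y) := by
    intro φ
    -- the character read on `Ext¹(ℤ, N)` through `nat`, as `α¹(∂ h)`
    let Φ : Abelian.Ext (triv (Γ := absoluteGaloisGroup K) ℤ) S.X₃ 1 →+ AddCircle (1 : ℚ) :=
      ((zmodToQmodZ n).comp φ).comp natE.symm.toAddMonoidHom
    have hΦ : ∀ y, Φ (nat y) = zmodToQmodZ n (φ y) := fun y => by
      change zmodToQmodZ n (φ (natE.symm (nat y))) = _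
      rw [← hnatE, AddEquiv.symm_apply_apply]
    obtain ⟨x, hx⟩ := hα.2 Φ
    obtain ⟨h, hh⟩ := boundary_surjective hS hPC x
    have hEHh : ∀ y, EH h y = zmodToQmodZ n (φ y) := fun y => by
      rw [← hΦ, ← hx, ← hh]
      rfl
    let c : shaTwo ρ := ⟨Ψ h, hΨsha h⟩
    have hΨd : Ψ (lift c.1 c.2 - h) = 0 := by rw [map_sub, hlift, sub_self]
    obtain ⟨f, hf⟩ := hΨker _ hΨd
    obtain ⟨Tf, hTf⟩ := hloc (-f)
    refine ⟨c, Tf, fun v => R v (-f), fun y S' hS' hy => ?_⟩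
    have hneg : h - lift c.1 c.2 = (-f) ≫ (ideleClassLimitShortComplex K).g := by
      rw [← neg_sub, hf]
      exact (Preadditive.neg_comp _ _).symm
    -- (rewrite at the level of values: `Hom(N₁, T.X₃)` and `Hom(N₁, C̄)` agree only up to unfolding)
    have key : eh (h - lift c.1 c.2) y = eh ((-f) ≫ (ideleClassLimitShortComplex K).g) y :=
      DFunLike.congr_fun (congrArg eh hneg) y
    rw [← hTf y S' hS' hy, ← key, heh_sub, AddMonoidHom.sub_apply, he]
    congr 1
    apply zmodToQmodZ_injective n
    rw [heh, hEHh]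
  -- gen 5's theorem for the canonical family
  obtain ⟨hfin, b, -, hb, hbflip⟩ :=
    sha_tateDual_of_readout LocalInvariants.canonical_isPerfect
      (unramifiedOrthogonal_of_isPerfect_allLevels _ LocalInvariants.canonical_isPerfect) hcomp ρ hM S₀ hinf hS₀
      e hadd hinj hsurj
  exact ⟨hfin, b, hb, hbflip⟩

end Road

end Summit.BirchSwinnertonDyer.BirchSwinnertonDyer.Theorems.PoitouTateShaTwoReadout

end
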